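import Summits.QuantumFields.BalabanUV.T4Continuum.Support.NE7SymmetricFermat
import Summits.QuantumFields.BalabanUV.T4Continuum.Support.AveragingDeficitMultiLevelFermat
import Summits.QuantumFields.BalabanUV.T4Continuum.Support.NE3CpushGaugeCovariance
import Literature.MathematicalPhysics.QuantumFieldTheory.Balaban1983to89.B7Prop6Flat
import Literature.MathematicalPhysics.QuantumFieldTheory.Balaban1983to89.B7BlockAvgLog
import HarnessLib

/-!
# NE7SymmetricFermatLevels — FERMAT FOR A SYMMETRIC RESTRICTED MINIMISER AT EVERY LEVEL OF THE TOWER: the multi-level (`(j+2)`-fold average) and the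
# one-level constraint maps of NE3-R2 (`levelQ`, `skewPR ∘ relLog`) are EQUIVARIANT under the dressing by a gauge transformation fixing the base, so
# `NE7SymmetricFermat.hasDerivAt_fineAction_vary_of_isLocalMin_symmetric` applies: a configuration fixed by `𝒦` which minimises the fine Wilson action of the
# period among the `𝒦`-FIXED small-field competitors with the same iterated average is critical along every `𝒦`-invariant tangent direction

Cell `pub-balaban`, rung (B)+1 sub-cell t4, lineage `b2b-balaban-t4-ne7b-p1` (row NE7b OWNER + CRUX PROVER; junction service for row NE7, ruling
R-OWNER-149-1 (2)), generation 158.  File 5 of the junction census of ROAD-G114 §8's STABILISER DESIGN ISSUE (files 1–4: `NE7InvariantFunctionalLetter`,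
`NE7SymmetricCriticality`, `NE7SymmetricAdmissibleWitness`, `NE7SymmetricFermat`).
THE ARGUMENT.  For `g` unitary periodic with `V^g = V` and `θ^g(r,κ) = Ad_{g(boxVec r + e_κ)} θ(r,κ)`: `chart_V(θ^g) = (chart_V θ)^g`
(`NE7SymmetricFermat.chart_dress`); `cavg(W^g) = (cavg W)^{g∘L•}` and `cavgIter (j+1) (W₁^{u}) = (cavgIter (j+1) W₁)^{u∘L^{j+1}•}` in the small-field class
(`NE3NestedBlockMeanCovariance.cavg_gaugeAct`, `NE3CpushGaugeCovariance.cavgIter_gaugeAct`), in particular the base `B = cavgIter (j+1) (cavg V)` is fixed by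
`g_top = g∘L^{j+2}•`; `relLog B (X^{g_top}) = Ad_{g_top(·+e_κ)} (relLog B X)` when `B^{g_top} = B` (`B7Prop6Flat.mlog_conj`); and `skewP ∘ Ad = Ad ∘ skewP`
(`NE7SymmetricFermat.skewP_Ad`).  Hence `levelQ (cavg V) (cavg (chart_V θ^g)) = R_g (levelQ (cavg V) (cavg (chart_V θ)))` for `θ` near `0`, with `R_g` the unitary
dressing of `skewSub M′` — an isometry of the Frobenius form.  The rest is NE3-R2's multi-level ∕ one-level Fermat (`NE3CurlPairedResidualMulti.hasDerivAt_fineAction_vary_multiLevel`,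
`NE7OpenOfMinimisation.hasDerivAt_fineAction_vary_oneLevel`) verbatim with the restricted minimality.
WHAT ([folklore]; 0 def, 0 sorry; every `d`, every `U(n)`).  §1 `relLog_gaugeAct_of_fixed`, `exists_adSkew`, `exists_frobSkew`; §2
**`hasDerivAt_fineAction_vary_multiLevel_symmetric`** (levels `j+2`); §3 **`hasDerivAt_fineAction_vary_oneLevel_symmetric`** (level `1`).
HONEST FRAMING (page 1): re-assembly of NE3-R2's kernel theorems with an equivariance bookkeeping; no estimate; nothing of Bałaban's asserted; NOT NE7, NOT NE3, row
NE7b NOT PRINTED ∕ NOT PROVED; spine 0∕9; finite T⁴ rung (B)+1 — NOT infinite volume, NOT mass gap, NOT BetaPertH, NOT Clay (continuum YM on T⁴ ⇐ BetaPertH ∧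
nine spine estimates).
-/

set_option autoImplicit false

open scoped BigOperators Matrix Matrix.Norms.L2Operator Topology
open NormedSpace Finset Filter

namespace Summit.QuantumFields.BalabanUV.T4Continuum.NE7SymmetricFermatLevels

open Literature.MathematicalPhysics.QuantumFieldTheory.Balaban1983to89
open B7Prop1Explicit B7Prop2Explicit MatrixLog UnitaryModel MatrixNorms
open T4AveragingDeficitWall hiding Site Plane Plaq Bond
open T4AveragingDeficitWallBoundary (IsPeriodicCfg periodBox)
open AveragingDeficitTransport AveragingDeficitPlaqDeriv AveragingDeficitSideDeriv AveragingDeficitPeriodicCounting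
open AveragingDeficitResidualPairing
open AveragingDeficitTorusChart AveragingDeficitChartCalculus AveragingDeficitFermat
open AveragingDeficitTwoLevelPrep AveragingDeficitMultiLevelPrep AveragingDeficitMultiLevelFermat
open AveragingDeficitNearIdentity (Ad_add Ad_zero)
open NE3EnergyShapes (IsUnitarySite IsPeriodicSite)
open NE3EnergyHessBilin (Ad_real_smul)
open NE3TangentCovariantTower (step_small)
open NE3NestedBlockMeanCovariance (cavg_gaugeAct)
open NE3CpushGaugeCovariance (cavgIter_gaugeAct)
open NE3CovariantCalculus (hsR hsR_self hsR_add_left hsR_add_right hsR_Ad)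
open NE3FrameFreeDecompositionPrep (hsR_smul_left hsR_smul_right)
open NE3LandauOrbit (eq_zero_of_nhsNormSq_eq_zero)
open NE7SymmetricFermat (skewP_Ad chart_dress hasDerivAt_fineAction_vary_of_isLocalMin_symmetric)

noncomputable section

variable {d : ℕ} {n : Type*} [Fintype n] [DecidableEq n]

/-! ## §1 Equivariance letters: relative logarithms at a fixed base; the unitary dressing of `skewSub`; its Frobenius form -/

/-- **RELATIVE LOGARITHMS AT A FIXED BASE ARE DRESSED COVARIANTLY**: if `B^{u} = B` then `relLog M B (X^{u}) (r,κ) = Ad_{u(boxVec r + e_κ)} (relLog M B X (r,κ))`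
(`B(b)⁻¹ u(x) X(b) u(x+e_κ)⁻¹ = u(x+e_κ) (B(b)⁻¹X(b)) u(x+e_κ)⁻¹` since `B(b) = u(x)B(b)u(x+e_κ)⁻¹`; `log` of a conjugate, `B7Prop6Flat.mlog_conj`). [folklore] -/
theorem relLog_gaugeAct_of_fixed (M : ℕ) {B : Site d → Fin d → (Matrix n n ℂ)ˣ} {u : Site d → (Matrix n n ℂ)ˣ} (hB : gaugeAct u B = B)
    (X : Site d → Fin d → (Matrix n n ℂ)ˣ) :
    relLog M B (gaugeAct u X) = fun r κ => Ad (u (boxVec M r + e κ)) (relLog M B X r κ) := by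
  funext r κ
  set x : Site d := boxVec M r with hx
  have hBb : u x * B x κ * (u (x + e κ))⁻¹ = B x κ := congr_fun (congr_fun hB x) κ
  have hunits : (B x κ)⁻¹ * (gaugeAct u X x κ) = u (x + e κ) * ((B x κ)⁻¹ * X x κ) * (u (x + e κ))⁻¹ := by
    show (B x κ)⁻¹ * (u x * X x κ * (u (x + e κ))⁻¹) = _
    conv_lhs => rw [← hBb]
    group
  simp only [relLog]
  have hval : (((B x κ)⁻¹ : (Matrix n n ℂ)ˣ) : Matrix n n ℂ) * ((gaugeAct u X x κ : (Matrix n n ℂ)ˣ) : Matrix n n ℂ)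
      = ((u (x + e κ) : (Matrix n n ℂ)ˣ) : Matrix n n ℂ) * ((((B x κ)⁻¹ : (Matrix n n ℂ)ˣ) : Matrix n n ℂ) * (X x κ : Matrix n n ℂ))
        * (((u (x + e κ))⁻¹ : (Matrix n n ℂ)ˣ) : Matrix n n ℂ) := by
    have h := congrArg (fun w : (Matrix n n ℂ)ˣ => (w : Matrix n n ℂ)) hunits
    simpa only [Units.val_mul] using h
  rw [hval, B7Prop6Flat.mlog_conj]
  rfl

/-- **THE UNITARY DRESSING OF `skewSub M`** by a family of unitaries `w(r,κ)`: a continuous linear map `T` of `skewSub M` with `(T Φ)(r,κ) = Ad_{w(r,κ)} Φ(r,κ)`.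
[folklore] -/
theorem exists_adSkew (M : ℕ) {w : (Fin d → Fin M) → Fin d → (Matrix n n ℂ)ˣ} (hw : ∀ r κ, w r κ ∈ unitaryUnits (Matrix n n ℂ)) :
    ∃ T : ↥(skewSub d n M) →L[ℝ] ↥(skewSub d n M), ∀ (Φ : ↥(skewSub d n M)) (r : Fin d → Fin M) (κ : Fin d),
      ((T Φ : ↥(skewSub d n M)) : TDir d n M) r κ = Ad (w r κ) ((Φ : TDir d n M) r κ) := by
  let Tₗ : ↥(skewSub d n M) →ₗ[ℝ] ↥(skewSub d n M) :=
    { toFun := fun Φ => ⟨fun r κ => Ad (w r κ) ((Φ : TDir d n M) r κ), fun r κ => Ad_mem_skewAdjoint (hw r κ) (Φ.2 r κ)⟩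
      map_add' := fun Φ Ψ => by
        apply Subtype.ext; funext r κ
        simp only [Submodule.coe_add, Pi.add_apply, Ad_add]
      map_smul' := fun c Φ => by
        apply Subtype.ext; funext r κ
        simp only [Submodule.coe_smul, Pi.smul_apply, Ad_real_smul, RingHom.id_apply] }
  exact ⟨LinearMap.toContinuousLinearMap Tₗ, fun Φ r κ => rfl⟩

/-- **THE FROBENIUS FORM ON `skewSub M`** is positive definite and invariant under every unitary dressing. [folklore] -/
theorem exists_frobSkew (M : ℕ) :
    ∃ B : ↥(skewSub d n M) →ₗ[ℝ] ↥(skewSub d n M) →ₗ[ℝ] ℝ,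
      (∀ Φ Ψ : ↥(skewSub d n M), B Φ Ψ = ∑ r : Fin d → Fin M, ∑ κ : Fin d, hsR ((Φ : TDir d n M) r κ) ((Ψ : TDir d n M) r κ)) ∧
      (∀ Φ : ↥(skewSub d n M), Φ ≠ 0 → 0 < B Φ Φ) := by
  let B : ↥(skewSub d n M) →ₗ[ℝ] ↥(skewSub d n M) →ₗ[ℝ] ℝ :=
    LinearMap.mk₂ ℝ (fun Φ Ψ => ∑ r : Fin d → Fin M, ∑ κ : Fin d, hsR ((Φ : TDir d n M) r κ) ((Ψ : TDir d n M) r κ))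
      (fun a a' b => by simp only [Submodule.coe_add, Pi.add_apply, hsR_add_left, sum_add_distrib])
      (fun c a b => by simp only [Submodule.coe_smul, Pi.smul_apply, hsR_smul_left, mul_sum, smul_eq_mul])
      (fun a b b' => by simp only [Submodule.coe_add, Pi.add_apply, hsR_add_right, sum_add_distrib])
      (fun c a b => by simp only [Submodule.coe_smul, Pi.smul_apply, hsR_smul_right, mul_sum, smul_eq_mul])
  refine ⟨B, fun _ _ => rfl, fun Φ hΦ => ?_⟩
  show 0 < ∑ r : Fin d → Fin M, ∑ κ : Fin d, hsR ((Φ : TDir d n M) r κ) ((Φ : TDir d n M) r κ)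
  have hnn : ∀ r ∈ (univ : Finset (Fin d → Fin M)), 0 ≤ ∑ κ : Fin d, hsR ((Φ : TDir d n M) r κ) ((Φ : TDir d n M) r κ) :=
    fun r _ => sum_nonneg fun κ _ => by rw [hsR_self]; exact nhsNormSq_nonneg _
  rcases (sum_nonneg hnn).lt_or_eq with hlt | heq
  · exact hlt
  · exfalso; apply hΦ
    apply Subtype.ext
    funext r κ
    have h1 := (sum_eq_zero_iff_of_nonneg hnn).1 heq.symm r (mem_univ _)
    have h2 := (sum_eq_zero_iff_of_nonneg (fun κ _ => by rw [hsR_self]; exact nhsNormSq_nonneg _)).1 h1 κ (mem_univ _)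
    rw [hsR_self] at h2
    exact eq_zero_of_nhsNormSq_eq_zero h2

/-- The dressing of `skewPR M Y` by unitaries is `skewPR M` of the dressed `Y` (`skewP ∘ Ad = Ad ∘ skewP`). [folklore] -/
theorem skewPR_Ad (M : ℕ) {w : (Fin d → Fin M) → Fin d → (Matrix n n ℂ)ˣ} (hw : ∀ r κ, w r κ ∈ unitaryUnits (Matrix n n ℂ))
    {T : ↥(skewSub d n M) →L[ℝ] ↥(skewSub d n M)}
    (hT : ∀ (Φ : ↥(skewSub d n M)) (r : Fin d → Fin M) (κ : Fin d), ((T Φ : ↥(skewSub d n M)) : TDir d n M) r κ = Ad (w r κ) ((Φ : TDir d n M) r κ))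
    (Y : TDir d n M) : skewPR M (fun r κ => Ad (w r κ) (Y r κ)) = T (skewPR M Y) := by
  apply Subtype.ext
  funext r κ
  rw [hT]
  simp only [skewPR, ContinuousLinearMap.coe_codRestrict_apply, skewPF_apply]
  exact skewP_Ad (hw r κ) _

/-! ## §2 Fermat for a symmetric restricted minimiser: levels `j+2` -/

/-- **THE SYMMETRIC RESTRICTED `(j+2)`-LEVEL MINIMISER IS CRITICAL ALONG EVERY INVARIANT TANGENT FINE DIRECTION.**  As
`NE3CurlPairedResidualMulti.hasDerivAt_fineAction_vary_multiLevel` (`V` unitary of period `L·(L·tower L M′ j)`, `SmallField V a`, `0 ≤ a < b`, `LevelSmall d L (j+1) b`), except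
that `V` is FIXED by a set `𝒦` of unitary gauge transformations of the period and minimises the fine Wilson action of the period only among the `𝒦`-FIXED unitary `U`
of the period with `SmallField U b` and `cavgIter L (j+2) U = cavgIter L (j+2) V`; conclusion for every skew periodic `𝒦`-INVARIANT `ψ` with
`TangentIter L j (cavg L V) (cpush L V ψ)`: `HasDerivAt (s ↦ A_fine(V e^{sψ})) 0 0`. [folklore] -/
theorem hasDerivAt_fineAction_vary_multiLevel_symmetric [Nonempty n] {L M' : ℕ} [NeZero L] [NeZero M'] (j : ℕ)
    {V : Site d → Fin d → (Matrix n n ℂ)ˣ} (hV : IsUnitaryCfg V) (hVP : IsPeriodicCfg V ((L : ℤ) * (L * tower L M' j : ℕ)))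
    {a b : ℝ} (ha : 0 ≤ a) (hab : a < b) (hb : LevelSmall d L (j + 1) b) (hVa : SmallField V a)
    (𝒦 : Set (Site d → (Matrix n n ℂ)ˣ)) (h𝒦u : ∀ g ∈ 𝒦, IsUnitarySite g)
    (h𝒦P : ∀ g ∈ 𝒦, IsPeriodicSite g ((L * (L * tower L M' j) : ℕ) : ℤ)) (h𝒦fix : ∀ g ∈ 𝒦, gaugeAct g V = V)
    (hmin : ∀ U : Site d → Fin d → (Matrix n n ℂ)ˣ, IsUnitaryCfg U → IsPeriodicCfg U ((L : ℤ) * (L * tower L M' j : ℕ)) →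
      SmallField U b → (∀ g ∈ 𝒦, gaugeAct g U = U) → cavgIter L (j + 2) U = cavgIter L (j + 2) V →
        fineAction V (blockWindow L (periodBox (L * tower L M' j))).2
          ≤ fineAction U (blockWindow L (periodBox (L * tower L M' j))).2)
    {ψ : Site d → Fin d → Matrix n n ℂ} (hψs : IsSkewDir ψ) (hψP : IsPeriodicDir ψ ((L : ℤ) * (L * tower L M' j : ℕ)))
    (hψK : ∀ g ∈ 𝒦, (fun y μ => Ad (g (y + e μ)) (ψ y μ)) = ψ)
    (hψT : TangentIter L j (cavg L V) (cpush L V ψ)) :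
    HasDerivAt (fun s : ℝ => fineAction (vary V ψ s) (blockWindow L (periodBox (L * tower L M' j))).2) 0 0 := by
  classical
  have hL : 1 ≤ L := Nat.one_le_iff_ne_zero.mpr (NeZero.ne L)
  have hb0 : 0 ≤ b := ha.trans hab.le
  have haS : LevelSmall d L (j + 1) a := LevelSmall.mono ha hab.le hb
  set N : ℕ := L * tower L M' j with hN
  haveI : NeZero N := ⟨Nat.mul_ne_zero (NeZero.ne L) (tower_ne_zero L M' j)⟩
  obtain ⟨hliftA, ha1, -, -⟩ := smallness_of_twoLevelSmall (d := d) hL ha haS.1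
  have h512a := small512_of_liftSmall hL ha hliftA
  obtain ⟨hliftB, hb1, -, -⟩ := smallness_of_twoLevelSmall (d := d) hL hb0 hb.1
  have h512b := small512_of_liftSmall hL hb0 hliftB
  -- the base `cavg L V` one level up
  have hV₁u : IsUnitaryCfg (cavg L V) := cavg_isUnitaryCfg hL hV ha h512a hVa
  have hV₁P : IsPeriodicCfg (cavg L V) ((L : ℤ) * (tower L M' j : ℕ)) := by
    have h := isPeriodicCfg_cavg L N hVP
    have e : ((N : ℕ) : ℤ) = (L : ℤ) * (tower L M' j : ℕ) := by rw [hN]; push_cast; ring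
    rw [e] at h
    exact h
  have hV₁a : SmallField (cavg L V) (prop1Radius d L a) := smallField_cavg hL hV ha h512a hVa
  have hQ := hasStrictFDerivAt_levelQ (M' := M') hL j hV₁u hV₁P ha1 haS.2 hV₁a
  have hQ' := levelQ'_onto (M' := M') hL j hV₁u hV₁P ha1 haS.2 hV₁a
  -- the top average of `V`
  have hVPt : IsPeriodicCfg V ((tower L M' (j + 2) : ℕ) : ℤ) := by rw [natCast_tower_succ]; exact hVP
  obtain ⟨hXVu, -, -⟩ := cavgIter_unitary_small hL (j + 1) hV ha haS hVa
  have hXVP : IsPeriodicCfg (cavgIter L (j + 2) V) (M' : ℤ) := isPeriodicCfg_cavgIter L M' (j + 2) hVPt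
  -- the side condition
  set Near : (Site d → Fin d → (Matrix n n ℂ)ˣ) → Prop := fun U => SmallField U b ∧ ∀ (r : Fin d → Fin M') (κ : Fin d),
    ‖(((cavgIter L (j + 2) V (boxVec M' r) κ)⁻¹ : (Matrix n n ℂ)ˣ) : Matrix n n ℂ)
      * (cavgIter L (j + 2) U (boxVec M' r) κ : Matrix n n ℂ) - 1‖ ≤ 1 / 4 with hNear
  have hVP' : IsPeriodicCfg V ((L * N : ℕ) : ℤ) := by rw [natCast_mul_period]; exact hVP
  have hNearE : ∀ᶠ θ in 𝓝 (0 : TDir d n (L * N)), Near (chart skewP (L * N) V θ) := by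
    refine (eventually_smallField_chart skewP (L * N) hVP' hab hVa).and ?_
    refine Filter.eventually_all.mpr fun r => Filter.eventually_all.mpr fun κ => ?_
    have hc0 := continuousAt_cavgIter_chart (d := d) (n := n) hL M' (j + 1) skewP hV hVP ha haS hVa (boxVec M' r) κ
    have hc : ContinuousAt (fun θ : TDir d n (L * N) =>
        ‖(((cavgIter L (j + 2) V (boxVec M' r) κ)⁻¹ : (Matrix n n ℂ)ˣ) : Matrix n n ℂ)
          * ((cavgIter L (j + 2) (chart skewP (L * N) V θ) (boxVec M' r) κ : (Matrix n n ℂ)ˣ) : Matrix n n ℂ) - 1‖) 0 :=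
      ((continuousAt_const.mul hc0).sub continuousAt_const).norm
    have h0 : ‖(((cavgIter L (j + 2) V (boxVec M' r) κ)⁻¹ : (Matrix n n ℂ)ˣ) : Matrix n n ℂ)
        * ((cavgIter L (j + 2) (chart skewP (L * N) V 0) (boxVec M' r) κ : (Matrix n n ℂ)ˣ) : Matrix n n ℂ) - 1‖ < 1 / 4 := by
      rw [chart_zero, Units.inv_mul, sub_self, norm_zero]
      norm_num
    exact (hc.eventually (gt_mem_nhds h0)).mono fun θ hθ => hθ.le
  -- the restricted minimality gives the chart-constrained restricted minimality under `Near`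
  have hmin' : ∀ U : Site d → Fin d → (Matrix n n ℂ)ˣ, IsUnitaryCfg U → IsPeriodicCfg U ((L : ℤ) * N) → Near U →
      (∀ g ∈ 𝒦, gaugeAct g U = U) →
      levelQ L M' j (cavg L V) (cavg L U) = levelQ L M' j (cavg L V) (cavg L V) →
        fineAction V (blockWindow L (periodBox N)).2 ≤ fineAction U (blockWindow L (periodBox N)).2 := by
    intro U hU hUP hUN hUfix hUQ
    obtain ⟨hUb, hUnear⟩ := hUN
    rw [levelQ_self] at hUQ
    have hUPt : IsPeriodicCfg U ((tower L M' (j + 2) : ℕ) : ℤ) := by rw [natCast_tower_succ]; exact hUP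
    obtain ⟨hXUu, -, -⟩ := cavgIter_unitary_small hL (j + 1) hU hb0 hb hUb
    have hXUP : IsPeriodicCfg (cavgIter L (j + 2) U) (M' : ℤ) := isPeriodicCfg_cavgIter L M' (j + 2) hUPt
    have heq : cavgIter L (j + 2) U = cavgIter L (j + 2) V :=
      eq_of_skewPR_relLog_eq_zero hXVP hXUP hXVu hXUu hUnear hUQ
    exact hmin U hU hUP hUb hUfix heq
  -- the tangency of the push-forward in the form `levelQ' … = 0`
  have hψP' : IsPeriodicDir (cpush L V ψ) ((L * tower L M' j : ℕ) : ℤ) := by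
    have h := isPeriodicDir_cpush L N hVP hψP
    rw [hN] at h
    exact h
  have hTc : levelQ' L M' j (cavg L V) (resDir (L * tower L M' j) fun y κ => pushDir L V ψ ((L : ℤ) • y) κ) = 0 :=
    levelQ'_resDir_eq_zero hL j hV₁u hV₁P (prop1Radius_nonneg ha) haS.2 hV₁a hψP' hψT
  -- THE NEW PART: the dressing `R` of `skewSub M′` by the top gauge, its Frobenius form, and the equivariance of `levelQ`
  obtain ⟨BG, hBG, hBGpos⟩ := exists_frobSkew (d := d) (n := n) M'
  have hRex : ∀ g : Site d → (Matrix n n ℂ)ˣ, g ∈ 𝒦 → ∃ T : ↥(skewSub d n M') →L[ℝ] ↥(skewSub d n M'),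
      ∀ (Φ : ↥(skewSub d n M')) (r : Fin d → Fin M') (κ : Fin d),
        ((T Φ : ↥(skewSub d n M')) : TDir d n M') r κ = Ad (g (((L : ℤ) ^ (j + 2)) • (boxVec M' r + e κ))) ((Φ : TDir d n M') r κ) :=
    fun g hg => exists_adSkew M' (w := fun r κ => g (((L : ℤ) ^ (j + 2)) • (boxVec M' r + e κ))) fun r κ => h𝒦u g hg _
  let R : (Site d → (Matrix n n ℂ)ˣ) → ↥(skewSub d n M') →L[ℝ] ↥(skewSub d n M') := fun g =>
    if hg : g ∈ 𝒦 then Classical.choose (hRex g hg) else ContinuousLinearMap.id ℝ _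
  have hR : ∀ g ∈ 𝒦, ∀ (Φ : ↥(skewSub d n M')) (r : Fin d → Fin M') (κ : Fin d),
      ((R g Φ : ↥(skewSub d n M')) : TDir d n M') r κ = Ad (g (((L : ℤ) ^ (j + 2)) • (boxVec M' r + e κ))) ((Φ : TDir d n M') r κ) := by
    intro g hg Φ r κ
    simp only [R, dif_pos hg]
    exact Classical.choose_spec (hRex g hg) Φ r κ
  have hRiso : ∀ g ∈ 𝒦, ∀ γ γ' : ↥(skewSub d n M'), BG (R g γ) (R g γ') = BG γ γ' := by
    intro g hg γ γ'
    rw [hBG, hBG]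
    refine sum_congr rfl fun r _ => sum_congr rfl fun κ _ => ?_
    rw [hR g hg, hR g hg]
    exact hsR_Ad (h𝒦u g hg _) _ _
  -- equivariance of the chart constraint near `0`
  have hQR : ∀ᶠ θ in 𝓝 (0 : TDir d n (L * N)), ∀ g ∈ 𝒦,
      levelQ L M' j (cavg L V) (cavg L (chart skewP (L * N) V (fun r κ => Ad (g (boxVec (L * N) r + e κ)) (θ r κ))))
        = R g (levelQ L M' j (cavg L V) (cavg L (chart skewP (L * N) V θ))) := by
    filter_upwards [eventually_smallField_chart skewP (L * N) hVP' hab hVa] with θ hθb g hg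
    have hgNP : IsPeriodicSite g ((L * N : ℕ) : ℤ) := h𝒦P g hg
    -- the three covariance steps for `W = chart_V θ` and for `V`
    have hchain : ∀ {W : Site d → Fin d → (Matrix n n ℂ)ˣ} {x : ℝ}, IsUnitaryCfg W → 0 ≤ x → LevelSmall d L (j + 1) x → SmallField W x →
        cavgIter L (j + 1) (cavg L (gaugeAct g W)) = gaugeAct (fun w => g (((L : ℤ) ^ (j + 2)) • w)) (cavgIter L (j + 1) (cavg L W)) := by
      intro W x hWu hx hs hWx
      obtain ⟨h512, hW₁u, hr0, hW₁x⟩ := step_small hL hWu hx hs.1 hWx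
      rw [cavg_gaugeAct hL hWu hx h512 hWx (h𝒦u g hg), cavgIter_gaugeAct hL j hW₁u hr0 hs.2 hW₁x (fun y => h𝒦u g hg _)]
      congr 1
      funext w
      simp only [smul_smul, ← pow_succ']
    have hWu : IsUnitaryCfg (chart skewP (L * N) V θ) := isUnitaryCfg_chart (L * N) hV θ
    have h1 := chart_dress (L * N) (h𝒦u g hg) hgNP (h𝒦fix g hg) θ
    have h2 := hchain hWu hb0 hb hθb
    have hBfix : gaugeAct (fun w => g (((L : ℤ) ^ (j + 2)) • w)) (cavgIter L (j + 1) (cavg L V)) = cavgIter L (j + 1) (cavg L V) := by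
      have h := hchain hV ha haS hVa
      rw [h𝒦fix g hg] at h
      exact h.symm
    show skewPR M' (relLog M' (cavgIter L (j + 1) (cavg L V)) (cavgIter L (j + 1) (cavg L (chart skewP (L * N) V
        (fun r κ => Ad (g (boxVec (L * N) r + e κ)) (θ r κ)))))) = R g (skewPR M' (relLog M' (cavgIter L (j + 1) (cavg L V))
        (cavgIter L (j + 1) (cavg L (chart skewP (L * N) V θ)))))
    rw [h1, h2, relLog_gaugeAct_of_fixed M' hBfix]
    exact skewPR_Ad M' (fun r κ => h𝒦u g hg _) (hR g hg) _
  have h𝒦P' : ∀ g ∈ 𝒦, IsPeriodicSite g ((L * N : ℕ) : ℤ) := fun g hg => h𝒦P g hg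
  exact hasDerivAt_fineAction_vary_of_isLocalMin_symmetric (M := N) hV hVP ha hliftA hVa (levelQ L M' j (cavg L V))
    (levelQ' L M' j (cavg L V)) hQ hQ' 𝒦 h𝒦u h𝒦P' h𝒦fix BG hBGpos R hRiso hQR Near hNearE hmin' hψs hψP hψK hTc

/-! ## §3 Fermat for a symmetric restricted minimiser: level `1` -/

/-- **THE SYMMETRIC RESTRICTED LEVEL-1 MINIMISER IS CRITICAL ALONG EVERY INVARIANT KERNEL DIRECTION OF THE FIRST AVERAGE.**  As
`NE7OpenOfMinimisation.hasDerivAt_fineAction_vary_oneLevel` (`U` unitary of period `L·N`, `SmallField U a`, `0 ≤ a < b`, `LevelSmall d L 0 b`), except that `U` is FIXED by a set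
`𝒦` of unitary gauge transformations of the period and minimises the fine Wilson action of the period only among the `𝒦`-FIXED unitary `W` of the period with
`SmallField W b` and `cavg L W = cavg L U`; conclusion for every skew periodic `𝒦`-INVARIANT `ψ` with `cpush L U ψ = 0`: `HasDerivAt (s ↦ A_fine(U e^{sψ})) 0 0`. [folklore] -/
theorem hasDerivAt_fineAction_vary_oneLevel_symmetric [Nonempty n] {L N : ℕ} [NeZero L] [NeZero N]
    {U : Site d → Fin d → (Matrix n n ℂ)ˣ} (hUu : IsUnitaryCfg U) (hUP : IsPeriodicCfg U ((L : ℤ) * N)) {a b : ℝ} (ha0 : 0 ≤ a) (hab : a < b)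
    (hb : LevelSmall d L 0 b) (hUa : SmallField U a)
    (𝒦 : Set (Site d → (Matrix n n ℂ)ˣ)) (h𝒦u : ∀ g ∈ 𝒦, IsUnitarySite g)
    (h𝒦P : ∀ g ∈ 𝒦, IsPeriodicSite g ((L * N : ℕ) : ℤ)) (h𝒦fix : ∀ g ∈ 𝒦, gaugeAct g U = U)
    (hmin : ∀ W : Site d → Fin d → (Matrix n n ℂ)ˣ, IsUnitaryCfg W → IsPeriodicCfg W ((L : ℤ) * N) → SmallField W b →
      (∀ g ∈ 𝒦, gaugeAct g W = W) → cavg L W = cavg L U →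
        fineAction U (blockWindow L (periodBox N)).2 ≤ fineAction W (blockWindow L (periodBox N)).2)
    {ψ : Site d → Fin d → Matrix n n ℂ} (hψs : IsSkewDir ψ) (hψP : IsPeriodicDir ψ ((L : ℤ) * N))
    (hψK : ∀ g ∈ 𝒦, (fun y μ => Ad (g (y + e μ)) (ψ y μ)) = ψ) (hψT : cpush L U ψ = 0) :
    HasDerivAt (fun s : ℝ => fineAction (vary U ψ s) (blockWindow L (periodBox N)).2) 0 0 := by
  classical
  have hL : 1 ≤ L := Nat.one_le_iff_ne_zero.mpr (NeZero.ne L)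
  have hb0 : 0 ≤ b := ha0.trans hab.le
  have haS : LevelSmall d L 0 a := LevelSmall.mono ha0 hab.le hb
  obtain ⟨hliftA, -, -, -⟩ := smallness_of_twoLevelSmall (d := d) hL ha0 haS
  obtain ⟨hliftB, -, -, -⟩ := smallness_of_twoLevelSmall (d := d) hL hb0 hb
  have h512b := small512_of_liftSmall hL hb0 hliftB
  have h512a := small512_of_liftSmall hL ha0 hliftA
  -- the base `X₀ = cavg L U`: unitary and `N`-periodic
  have hX₀u : IsUnitaryCfg (cavg L U) := cavg_isUnitaryCfg hL hUu ha0 h512a hUa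
  have hX₀P : IsPeriodicCfg (cavg L U) (N : ℤ) := isPeriodicCfg_cavg L N hUP
  -- the constraint through the chart coordinates of the first average: `Q W = skewPR (relLog (cavg U) W)`
  set Q : (Site d → Fin d → (Matrix n n ℂ)ˣ) → ↥(skewSub d n N) := fun W => skewPR N (relLog N (cavg L U) W) with hQdef
  have hQ : HasStrictFDerivAt (fun Φ : TDir d n N => Q (chart (ContinuousLinearMap.id ℝ (Matrix n n ℂ)) N (cavg L U) Φ)) (skewPR N) 0 := by
    refine ((skewPR (d := d) (n := n) N).hasStrictFDerivAt (x := 0)).congr_of_eventuallyEq ?_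
    have hball : Metric.ball (0 : TDir d n N) (Real.log 2) ∈ 𝓝 (0 : TDir d n N) := Metric.ball_mem_nhds _ (Real.log_pos one_lt_two)
    filter_upwards [hball] with Φ hΦ
    rw [mem_ball_zero_iff] at hΦ
    show (skewPR N) Φ = skewPR N (relLog N (cavg L U) (chart (ContinuousLinearMap.id ℝ (Matrix n n ℂ)) N (cavg L U) Φ))
    congr 1
    funext r κ
    have hn : ‖Φ r κ‖ < Real.log 2 := lt_of_le_of_lt ((norm_le_pi_norm (Φ r) κ).trans (norm_le_pi_norm Φ r)) hΦ
    simp only [relLog, chart, AveragingDeficitTorusChart.chartDir, ContinuousLinearMap.id_apply, redN_boxVec, Units.val_mul, val_expUnit,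
      ← mul_assoc, Units.inv_mul, one_mul]
    exact (B7BlockAvgLog.mlog_exp hn).symm
  have hQ' : ∀ γ : ↥(skewSub d n N), ∃ Φ : TDir d n N, (∀ r κ, Φ r κ ∈ skewAdjoint (Matrix n n ℂ)) ∧ skewPR N Φ = γ := fun γ =>
    ⟨(γ : TDir d n N), fun r κ => γ.2 r κ, Subtype.ext (skewPF_of_mem γ.2)⟩
  -- the side condition: class radius and first averages relatively within `1∕4`
  set Near : (Site d → Fin d → (Matrix n n ℂ)ˣ) → Prop := fun W => SmallField W b ∧ ∀ (r : Fin d → Fin N) (κ : Fin d),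
    ‖(((cavg L U (boxVec N r) κ)⁻¹ : (Matrix n n ℂ)ˣ) : Matrix n n ℂ) * (cavg L W (boxVec N r) κ : Matrix n n ℂ) - 1‖ ≤ 1 / 4 with hNear
  have hUPLN : IsPeriodicCfg U ((L * N : ℕ) : ℤ) := by rw [natCast_mul_period]; exact hUP
  have hUPt : IsPeriodicCfg U ((L : ℤ) * (tower L N 0 : ℕ)) := hUP
  have hNearE : ∀ᶠ θ in 𝓝 (0 : TDir d n (L * N)), Near (chart skewP (L * N) U θ) := by
    refine (eventually_smallField_chart skewP (L * N) hUPLN hab hUa).and ?_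
    refine Filter.eventually_all.mpr fun r => Filter.eventually_all.mpr fun κ => ?_
    have hc0 := continuousAt_cavgIter_chart (d := d) (n := n) hL N 0 skewP hUu hUPt ha0 haS hUa (boxVec N r) κ
    have hc : ContinuousAt (fun θ : TDir d n (L * N) =>
        ‖(((cavg L U (boxVec N r) κ)⁻¹ : (Matrix n n ℂ)ˣ) : Matrix n n ℂ)
          * ((cavgIter L 1 (chart skewP (L * N) U θ) (boxVec N r) κ : (Matrix n n ℂ)ˣ) : Matrix n n ℂ) - 1‖) 0 :=
      ((continuousAt_const.mul hc0).sub continuousAt_const).norm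
    have h0 : ‖(((cavg L U (boxVec N r) κ)⁻¹ : (Matrix n n ℂ)ˣ) : Matrix n n ℂ)
        * ((cavgIter L 1 (chart skewP (L * N) U 0) (boxVec N r) κ : (Matrix n n ℂ)ˣ) : Matrix n n ℂ) - 1‖ < 1 / 4 := by
      rw [chart_zero]
      show ‖(((cavg L U (boxVec N r) κ)⁻¹ : (Matrix n n ℂ)ˣ) : Matrix n n ℂ) * ((cavg L U (boxVec N r) κ : (Matrix n n ℂ)ˣ) : Matrix n n ℂ) - 1‖ < 1 / 4
      rw [Units.inv_mul, sub_self, norm_zero]; norm_num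
    exact (hc.eventually (gt_mem_nhds h0)).mono fun θ hθ => hθ.le
  -- the restricted minimality gives the chart-constrained restricted minimality under `Near`
  have hmin' : ∀ W : Site d → Fin d → (Matrix n n ℂ)ˣ, IsUnitaryCfg W → IsPeriodicCfg W ((L : ℤ) * N) → Near W →
      (∀ g ∈ 𝒦, gaugeAct g W = W) →
      Q (cavg L W) = Q (cavg L U) → fineAction U (blockWindow L (periodBox (d := d) N)).2 ≤ fineAction W (blockWindow L (periodBox (d := d) N)).2 := by
    intro W hW hWP hWN hWfix hWQ
    obtain ⟨hWx, hWnear⟩ := hWN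
    have hQ0 : skewPR N (relLog N (cavg L U) (cavg L W)) = 0 := by
      have h : Q (cavg L W) = Q (cavg L U) := hWQ
      simp only [hQdef, relLog_self, map_zero] at h
      exact h
    have hWXu : IsUnitaryCfg (cavg L W) := cavg_isUnitaryCfg hL hW hb0 h512b hWx
    have hWXP : IsPeriodicCfg (cavg L W) (N : ℤ) := isPeriodicCfg_cavg L N hWP
    have heq : cavg L W = cavg L U := eq_of_skewPR_relLog_eq_zero hX₀P hWXP hX₀u hWXu hWnear hQ0
    exact hmin W hW hWP hWx hWfix heq
  have hTc : skewPR N (resDir N fun y κ => pushDir L U ψ ((L : ℤ) • y) κ) = 0 := by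
    have h0 : (fun y κ => pushDir L U ψ ((L : ℤ) • y) κ) = cpush L U ψ := rfl
    rw [h0, hψT]
    have h1 : resDir N (0 : Site d → Fin d → Matrix n n ℂ) = 0 := by funext r κ; rfl
    rw [h1, map_zero]
  -- THE NEW PART: the dressing `R` of `skewSub N` by the coarse gauge, its Frobenius form, and the equivariance of `Q`
  obtain ⟨BG, hBG, hBGpos⟩ := exists_frobSkew (d := d) (n := n) N
  have hRex : ∀ g : Site d → (Matrix n n ℂ)ˣ, g ∈ 𝒦 → ∃ T : ↥(skewSub d n N) →L[ℝ] ↥(skewSub d n N),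
      ∀ (Φ : ↥(skewSub d n N)) (r : Fin d → Fin N) (κ : Fin d),
        ((T Φ : ↥(skewSub d n N)) : TDir d n N) r κ = Ad (g ((L : ℤ) • (boxVec N r + e κ))) ((Φ : TDir d n N) r κ) :=
    fun g hg => exists_adSkew N (w := fun r κ => g ((L : ℤ) • (boxVec N r + e κ))) fun r κ => h𝒦u g hg _
  let R : (Site d → (Matrix n n ℂ)ˣ) → ↥(skewSub d n N) →L[ℝ] ↥(skewSub d n N) := fun g =>
    if hg : g ∈ 𝒦 then Classical.choose (hRex g hg) else ContinuousLinearMap.id ℝ _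
  have hR : ∀ g ∈ 𝒦, ∀ (Φ : ↥(skewSub d n N)) (r : Fin d → Fin N) (κ : Fin d),
      ((R g Φ : ↥(skewSub d n N)) : TDir d n N) r κ = Ad (g ((L : ℤ) • (boxVec N r + e κ))) ((Φ : TDir d n N) r κ) := by
    intro g hg Φ r κ
    simp only [R, dif_pos hg]
    exact Classical.choose_spec (hRex g hg) Φ r κ
  have hRiso : ∀ g ∈ 𝒦, ∀ γ γ' : ↥(skewSub d n N), BG (R g γ) (R g γ') = BG γ γ' := by
    intro g hg γ γ'
    rw [hBG, hBG]
    refine sum_congr rfl fun r _ => sum_congr rfl fun κ _ => ?_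
    rw [hR g hg, hR g hg]
    exact hsR_Ad (h𝒦u g hg _) _ _
  have hQR : ∀ᶠ θ in 𝓝 (0 : TDir d n (L * N)), ∀ g ∈ 𝒦,
      Q (cavg L (chart skewP (L * N) U (fun r κ => Ad (g (boxVec (L * N) r + e κ)) (θ r κ)))) = R g (Q (cavg L (chart skewP (L * N) U θ))) := by
    filter_upwards [eventually_smallField_chart skewP (L * N) hUPLN hab hUa] with θ hθb g hg
    have hgNP : IsPeriodicSite g ((L * N : ℕ) : ℤ) := h𝒦P g hg
    have hWu : IsUnitaryCfg (chart skewP (L * N) U θ) := isUnitaryCfg_chart (L * N) hUu θ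
    have h1 := chart_dress (L * N) (h𝒦u g hg) hgNP (h𝒦fix g hg) θ
    have h2 := cavg_gaugeAct hL hWu hb0 h512b hθb (h𝒦u g hg)
    have hBfix : gaugeAct (fun w => g ((L : ℤ) • w)) (cavg L U) = cavg L U := by
      have h := cavg_gaugeAct hL hUu ha0 h512a hUa (h𝒦u g hg)
      rw [h𝒦fix g hg] at h
      exact h.symm
    show skewPR N (relLog N (cavg L U) (cavg L (chart skewP (L * N) U (fun r κ => Ad (g (boxVec (L * N) r + e κ)) (θ r κ)))))
      = R g (skewPR N (relLog N (cavg L U) (cavg L (chart skewP (L * N) U θ))))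
    rw [h1, h2, relLog_gaugeAct_of_fixed N hBfix]
    have h3 : (fun r κ => Ad ((fun w => g ((L : ℤ) • w)) (boxVec N r + e κ)) (relLog N (cavg L U) (cavg L (chart skewP (L * N) U θ)) r κ))
        = fun r κ => Ad (g ((L : ℤ) • (boxVec N r + e κ))) (relLog N (cavg L U) (cavg L (chart skewP (L * N) U θ)) r κ) := rfl
    rw [h3]
    exact skewPR_Ad N (fun r κ => h𝒦u g hg _) (hR g hg) _
  exact hasDerivAt_fineAction_vary_of_isLocalMin_symmetric (M := N) hUu hUP ha0 hliftA hUa Q (skewPR N) hQ hQ' 𝒦 h𝒦u h𝒦P h𝒦fix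
    BG hBGpos R hRiso hQR Near hNearE hmin' hψs hψP hψK hTc

end

end Summit.QuantumFields.BalabanUV.T4Continuum.NE7SymmetricFermatLevels
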